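import Summits.CriticalPhenomena.PercolationContinuityZ3.Theorems.Transplant.CayleyCylinderAdmissible
import HarnessLib

/-!
# Cylinders of a Cayley-graph skeleton V — the signed frame with a corner excursion (letters-only 2-step nilpotent groups)

builds on p205010 (kernel theorem, internal audit signed; external expert review pending) — nothing in this file uses p205010.
Lane `prim-bschramm`, seat `prim-bschramm-p4` gen 10 (PART C3 of `P4-GENERAL.md`, "tier 2″").  Helper file
(`--supports stmt-CriticalPhenomena-4575 --as helper`).

For `D : CylData₁ Γ S` (file IV), `H = Cay(Γ;S)[V_{ℓ+1}]`, an edge `{x, y}` of the small cylinder and a sign `σ = ±1`, the SIGNED FRAME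
`p → c₁ → c₂ → c₃ → q`: from the floor point `p = x s₀^{−n_A}` along `t_σ = s₁^{σ}` to the corner `c₁ = (−(ℓ+1), σ(ℓ+1))`, up the wall to the
corner `c₂ = (ℓ+1, σ(ℓ+1))`, then the CORNER EXCURSION — the admissible kernel word of `k = c₂⁻¹ q t_σ^{m₂}` translated to `c₂` (vertices at
`{ℓ, ℓ+1} × {σℓ, σ(ℓ+1)}`, never two deep vertices `(ℓ, σℓ)` in a row) — to `c₃ = c₂ k`, and along `t_σ⁻¹` on the ceiling to `q = y s₀^{n_B}`.
Outputs for the cycle kit of file VI: every frame vertex lies in the big cylinder and is outside the small one or equal in height to `(ℓ, σℓ)`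
(`frame_mem`); every frame edge has an endpoint outside the small cylinder (`frame_darts`); the columns and the frame as walks / a simple
path of `H` (`colA`, `colB`, `pathM`) with their supports.  All `φ`-bookkeeping is imported through `D.enl` (files II–III).
-/

noncomputable section

namespace Summit.CriticalPhenomena.PercolationContinuityZ3.Theorems.Transplant

namespace CayCyl

open SimpleGraph Walk Literature.Probability.LatticeModels Literature.Probability.Percolation
open scoped Classical

variable {Γ : Type} [Group Γ] {S : Finset Γ}

/-- Edges of an induced walk come from edges of the walk. [folklore] -/
theorem mem_edges_of_mem_edges_induce {W : Type} {G : SimpleGraph W} {s : Set W} {u v : W} (w : G.Walk u v)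
    (hw : ∀ z ∈ w.support, z ∈ s) {a b : s} (h : s(a, b) ∈ (w.induce s hw).edges) : s(a.1, b.1) ∈ w.edges := by
  have h' : s(a.1, b.1) ∈ ((w.induce s hw).map (Embedding.induce s).toHom).edges := by
    rw [Walk.edges_map]; exact List.mem_map.2 ⟨s(a, b), h, rfl⟩
  rwa [Walk.map_induce] at h'

/-- An edge of a walk is the edge of one of its darts. [folklore] -/
theorem exists_dart_of_mem_edges {W : Type} {G : SimpleGraph W} {u v a b : W} (w : G.Walk u v) (h : s(a, b) ∈ w.edges) :
    ∃ d ∈ w.darts, (d.fst = a ∧ d.snd = b) ∨ (d.fst = b ∧ d.snd = a) := by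
  simp only [Walk.edges, List.mem_map] at h
  obtain ⟨d, hd, he⟩ := h
  exact ⟨d, hd, dart_edge_eq_mk'_iff'.1 he⟩

namespace CylData₁

variable (D : CylData₁ Γ S)

/-- The cylinder graph `H_L = Cay(Γ;S)[V_L]` (vertex set from the enlarged datum, edges from `S`). [cite: KozmaNitzan2024, §4 p. 15 (boxes)] -/
abbrev cylG (L : ℕ) : SimpleGraph (D.enl.V L) := (mulCayley (S : Set Γ)).induce (D.enl.V L)

/-- `enl.s₀ = s₀`. [folklore] -/
@[simp] theorem enl_s₀ : D.enl.s₀ = D.s₀ := rfl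

/-- Membership in a cylinder, in terms of `D.φ`. [folklore] -/
theorem memV {L : ℕ} {g : Γ} : g ∈ D.enl.V L ↔ |D.φ g 0| ≤ L ∧ |D.φ g 1| ≤ L := D.enl.memV

/-- Membership of a point of `ℤ²` in a box, coordinatewise. [folklore] -/
theorem mem_box_two {L : ℕ} {z : Site 2} : z ∈ box 2 L ↔ |z 0| ≤ L ∧ |z 1| ≤ L := by
  simp only [mem_box, Fin.forall_fin_two, abs_le]

/-- `φ 1 = 0` for the datum (through `enl`). [folklore] -/
theorem φ_one₁ : D.φ (1 : Γ) = 0 := D.enl.φ_one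

section KitDir

variable {ℓ : ℕ} (σ : ℤ) (x y : D.enl.V (ℓ + 1))

/-- Steps from `φ₁ x` to the wall `φ₁ = σ(ℓ+1)`. [folklore] -/
def m₁ : ℕ := ((ℓ : ℤ) + 1 - σ * D.φ x.1 1).toNat

/-- Steps from the wall back to `φ₁ y`. [folklore] -/
def m₂ : ℕ := ((ℓ : ℤ) + 1 - σ * D.φ y.1 1).toNat

variable {σ}

/-- `m₁` as an integer. [folklore] -/
theorem m₁_eq (hσ : σ = 1 ∨ σ = -1) : (D.m₁ σ x : ℤ) = ℓ + 1 - σ * D.φ x.1 1 := by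
  have h := (D.memV.1 x.2).2; rw [abs_le] at h
  rw [m₁, Int.toNat_of_nonneg]; rcases hσ with rfl | rfl <;> simp <;> omega

/-- `m₂` as an integer. [folklore] -/
theorem m₂_eq (hσ : σ = 1 ∨ σ = -1) : (D.m₂ σ y : ℤ) = ℓ + 1 - σ * D.φ y.1 1 := by
  have h := (D.memV.1 y.2).2; rw [abs_le] at h
  rw [m₂, Int.toNat_of_nonneg]; rcases hσ with rfl | rfl <;> simp <;> omega

variable (σ)

/-- The first corner `c₁ = p t_σ^{m₁}`. [folklore] -/
abbrev c₁ : Γ := D.enl.pt x * D.t σ ^ D.m₁ σ x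

/-- The second corner `c₂ = c₁ s₀^{2ℓ+2}` (the excursion corner). [folklore] -/
abbrev c₂ : Γ := D.enl.pt x * D.t σ ^ D.m₁ σ x * D.enl.s₀ ^ (2 * (ℓ + 1))

/-- The kernel element of the excursion: `k = c₂⁻¹ q t_σ^{m₂}`. [folklore] -/
def kel : Γ := (D.c₂ σ x)⁻¹ * D.enl.qt y * D.t σ ^ D.m₂ σ y

/-- The third point `c₃ = c₂ k`. [folklore] -/
abbrev c₃ : Γ := D.c₂ σ x * D.kel σ x y

variable {σ}

/-- Coordinates of `c₁`. [folklore] -/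
theorem φ_c₁ (hσ : σ = 1 ∨ σ = -1) : D.φ (D.c₁ σ x) 0 = -(ℓ + 1 : ℤ) ∧ D.φ (D.c₁ σ x) 1 = σ * (ℓ + 1 : ℤ) := by
  have h := D.φ_t_pow hσ (D.enl.pt x) (D.m₁ σ x); have hp := D.enl.φ_pt x; have e := D.m₁_eq x hσ
  rw [enl_φ] at hp
  refine ⟨by rw [h.1, hp.1], ?_⟩
  rw [h.2, hp.2, e]; rcases hσ with rfl | rfl <;> ring

/-- Coordinates of `c₂`. [folklore] -/
theorem φ_c₂ (hσ : σ = 1 ∨ σ = -1) : D.φ (D.c₂ σ x) 0 = (ℓ + 1 : ℤ) ∧ D.φ (D.c₂ σ x) 1 = σ * (ℓ + 1 : ℤ) := by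
  have h := D.enl.φ_s₀_pow (D.c₁ σ x) (2 * (ℓ + 1)); have hc := D.φ_c₁ x hσ
  rw [enl_φ] at h
  refine ⟨?_, by rw [h.2, hc.2]⟩
  rw [h.1, hc.1]; push_cast; ring

/-- `k ∈ ker φ`. [folklore] -/
theorem φ_kel (hσ : σ = 1 ∨ σ = -1) : D.φ (D.kel σ x y) = 0 := by
  have h1 := D.φ_c₂ x hσ; have h2 := D.enl.φ_qt y; have h3 := D.φ_t_pow hσ (1 : Γ) (D.m₂ σ y); have e := D.m₂_eq y hσ
  rw [enl_φ] at h2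
  rw [one_mul, D.φ_one₁] at h3
  have hinv : D.φ (D.c₂ σ x)⁻¹ = -D.φ (D.c₂ σ x) := D.enl.φ_inv _
  funext j
  rw [kel, D.map_mul, D.map_mul, hinv]
  fin_cases j
  · show -D.φ (D.c₂ σ x) 0 + D.φ (D.enl.qt y) 0 + D.φ (D.t σ ^ D.m₂ σ y) 0 = 0
    rw [h1.1, h2.1, h3.1]; simp
  · show -D.φ (D.c₂ σ x) 1 + D.φ (D.enl.qt y) 1 + D.φ (D.t σ ^ D.m₂ σ y) 1 = 0
    rw [h1.2, h2.2, h3.2, e]; simp only [Pi.zero_apply, zero_add]; rcases hσ with rfl | rfl <;> ring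

/-- The ceiling closes the frame: `c₃ t_σ^{−m₂} = q`. [folklore] -/
theorem c₃_end : D.c₃ σ x y * (D.t σ)⁻¹ ^ D.m₂ σ y = D.enl.qt y := by
  show D.c₂ σ x * ((D.c₂ σ x)⁻¹ * D.enl.qt y * D.t σ ^ D.m₂ σ y) * (D.t σ)⁻¹ ^ D.m₂ σ y = D.enl.qt y
  rw [inv_pow, mul_assoc (D.c₂ σ x)⁻¹, mul_inv_cancel_left, mul_inv_cancel_right]

variable (σ)

/-- The corner excursion: the admissible word of `k`, translated to `c₂`. [folklore] -/
def seg (hσ : σ = 1 ∨ σ = -1) : (mulCayley (S : Set Γ)).Walk (D.c₂ σ x) (D.c₃ σ x y) :=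
  (lmul S (D.c₂ σ x) (D.admWalk hσ (D.kel σ x y) (D.φ_kel x y hσ))).copy (mul_one _) rfl

/-- **The signed frame** `p → c₁ → c₂ → c₃ → q`. [folklore] -/
def frame (hσ : σ = 1 ∨ σ = -1) : (mulCayley (S : Set Γ)).Walk (D.enl.pt x) (D.enl.qt y) :=
  (powWalk S (D.adj_t σ) (D.enl.pt x) (D.m₁ σ x)).append <|
    (powWalk S (fun g => adj_mul_of_mem S (t := D.enl.s₀) (Or.inl D.s₀_mem) D.enl.s₀_ne_one g) (D.c₁ σ x) (2 * (ℓ + 1))).append <|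
      (D.seg σ x y hσ).append ((powWalk S (D.adj_t_inv σ) (D.c₃ σ x y) (D.m₂ σ y)).copy rfl (D.c₃_end x y))

variable {σ}

/-- The length of the excursion. [folklore] -/
theorem length_seg (hσ : σ = 1 ∨ σ = -1) : (D.seg σ x y hσ).length = D.admLen σ (D.kel σ x y) := by
  simp only [seg, Walk.length_copy, length_lmul, D.length_admWalk]

/-- Heights along the excursion: admissible offsets from `(ℓ+1, σ(ℓ+1))`. [folklore] -/
theorem φ_seg (hσ : σ = 1 ∨ σ = -1) {v : Γ} (hv : v ∈ (D.seg σ x y hσ).support) :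
    (D.φ v 0 = ℓ + 1 ∨ D.φ v 0 = ℓ) ∧ (D.φ v 1 = σ * (ℓ + 1) ∨ D.φ v 1 = σ * ℓ) := by
  rw [seg, support_copy] at hv
  obtain ⟨v', hv', rfl⟩ := mem_support_lmul.1 hv
  have h0 := (D.admWalk_good hσ _ (D.φ_kel x y hσ)).1 v' hv'
  rw [D.φ_one₁, sub_zero] at h0
  have hc := D.φ_c₂ x hσ
  rw [D.map_mul, Pi.add_apply, Pi.add_apply, hc.1, hc.2]
  refine ⟨?_, ?_⟩
  · rcases h0.1 with h | h <;> rw [h] <;> [left; right] <;> ring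
  · rcases h0.2 with h | h <;> rw [h] <;> [left; right] <;> ring

/-- Darts of the excursion never join two deep vertices `(ℓ, σℓ)`. [folklore] -/
theorem darts_seg (hσ : σ = 1 ∨ σ = -1) {d : (mulCayley (S : Set Γ)).Dart} (hd : d ∈ (D.seg σ x y hσ).darts) :
    ¬((D.φ d.fst 0 = ℓ ∧ D.φ d.fst 1 = σ * ℓ) ∧ (D.φ d.snd 0 = ℓ ∧ D.φ d.snd 1 = σ * ℓ)) := by
  have hg := D.good_lmul (D.c₂ σ x) (D.admWalk_good hσ _ (D.φ_kel x y hσ))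
  rw [seg, darts_copy] at hd
  have h := hg.2 d hd
  have hc := D.φ_c₂ x hσ
  have hb : D.φ (D.c₂ σ x * 1) = D.φ (D.c₂ σ x) := by rw [mul_one]
  rintro ⟨⟨h1, h2⟩, ⟨h3, h4⟩⟩
  refine h ⟨⟨?_, ?_⟩, ⟨?_, ?_⟩⟩ <;> simp only [hb, Pi.sub_apply, hc.1, hc.2, h1, h2, h3, h4] <;> ring

/-- **Every frame vertex lies in the big cylinder, and is outside the small one or at height `(ℓ, σℓ)`.** [folklore] -/
theorem frame_mem (hσ : σ = 1 ∨ σ = -1) {v : Γ} (hv : v ∈ (D.frame σ x y hσ).support) :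
    v ∈ D.enl.V (ℓ + 1) ∧ (D.φ v ∉ box 2 ℓ ∨ (D.φ v 0 = ℓ ∧ D.φ v 1 = σ * ℓ)) := by
  have hx1 := (D.memV.1 x.2).2; have hy1 := (D.memV.1 y.2).2
  rw [abs_le] at hx1 hy1
  rw [D.memV, mem_box_two, abs_le, abs_le, abs_le, abs_le]
  rw [frame] at hv
  rcases (Walk.mem_support_append_iff _ _).1 hv with hv | hv
  · obtain ⟨i, hi, rfl⟩ := (mem_support_powWalk _).1 hv
    have h := D.φ_t_pow hσ (D.enl.pt x) i; have hp := D.enl.φ_pt x; have e := D.m₁_eq x hσ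
    rw [enl_φ] at hp
    have hi' : (i : ℤ) ≤ D.m₁ σ x := by exact_mod_cast hi
    rw [h.1, h.2, hp.1, hp.2]
    refine ⟨?_, Or.inl ?_⟩ <;> rcases hσ with rfl | rfl <;> omega
  rcases (Walk.mem_support_append_iff _ _).1 hv with hv | hv
  · obtain ⟨i, hi, rfl⟩ := (mem_support_powWalk _).1 hv
    have h := D.enl.φ_s₀_pow (D.c₁ σ x) i; have hc := D.φ_c₁ x hσ
    rw [enl_φ] at h
    have hi' : (i : ℤ) ≤ 2 * (ℓ + 1) := by exact_mod_cast hi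
    rw [h.1, h.2, hc.1, hc.2]
    refine ⟨?_, Or.inl ?_⟩ <;> rcases hσ with rfl | rfl <;> omega
  rcases (Walk.mem_support_append_iff _ _).1 hv with hv | hv
  · have h := D.φ_seg x y hσ hv
    refine ⟨?_, ?_⟩
    · rcases h.1 with h0 | h0 <;> rcases h.2 with h1 | h1 <;> rw [h0, h1] <;> rcases hσ with rfl | rfl <;> omega
    · rcases h.1 with h0 | h0 <;> rcases h.2 with h1 | h1
      · left; rw [h0]; omega
      · left; rw [h0]; omega
      · left; rw [h1]; rcases hσ with rfl | rfl <;> omega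
      · exact Or.inr ⟨h0, h1⟩
  · rw [support_copy] at hv
    obtain ⟨i, hi, rfl⟩ := (mem_support_powWalk _).1 hv
    have h := D.φ_t_inv_pow hσ (D.c₃ σ x y) i
    have hend := D.φ_t_inv_pow hσ (D.c₃ σ x y) (D.m₂ σ y)
    rw [D.c₃_end x y] at hend
    have hq := D.enl.φ_qt y; rw [enl_φ] at hq
    have e := D.m₂_eq y hσ
    have hi' : (i : ℤ) ≤ D.m₂ σ y := by exact_mod_cast hi
    have h30 : D.φ (D.c₃ σ x y) 0 = ℓ + 1 := by rw [← hend.1, hq.1]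
    have h31 : D.φ (D.c₃ σ x y) 1 = D.φ y.1 1 + σ * (D.m₂ σ y) := by have := hend.2; rw [hq.2] at this; linarith
    rw [e] at hi' h31
    rw [h.1, h.2, h30, h31]
    refine ⟨?_, Or.inl ?_⟩ <;> rcases hσ with rfl | rfl <;> push_cast <;> omega

/-- **Every frame edge has an endpoint outside the small cylinder.** [folklore] -/
theorem frame_darts (hσ : σ = 1 ∨ σ = -1) {d : (mulCayley (S : Set Γ)).Dart} (hd : d ∈ (D.frame σ x y hσ).darts) :
    D.φ d.fst ∉ box 2 ℓ ∨ D.φ d.snd ∉ box 2 ℓ := by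
  have hfst := (D.frame_mem x y hσ (Walk.dart_fst_mem_support_of_mem_darts _ hd)).2
  have hsnd := (D.frame_mem x y hσ (Walk.dart_snd_mem_support_of_mem_darts _ hd)).2
  rcases hfst with h | h
  · exact Or.inl h
  rcases hsnd with h' | h'
  · exact Or.inr h'
  -- both endpoints deep: the dart is an excursion dart, contradiction
  exfalso
  rw [frame, darts_append, List.mem_append, darts_append, List.mem_append, darts_append, List.mem_append, darts_copy] at hd
  have hout : ∀ {g : Γ}, (D.φ g 0 = -(ℓ + 1 : ℤ) ∨ D.φ g 0 = ℓ + 1 ∨ D.φ g 1 = σ * (ℓ + 1)) → ¬(D.φ g 0 = ℓ ∧ D.φ g 1 = σ * ℓ) := by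
    rintro g (hg | hg | hg) ⟨h0, h1⟩
    · rw [hg] at h0; omega
    · rw [hg] at h0; omega
    · rw [hg] at h1; rcases hσ with rfl | rfl <;> omega
  rcases hd with hd | hd | hd | hd
  · have hm := Walk.dart_fst_mem_support_of_mem_darts _ hd
    obtain ⟨i, -, hi⟩ := (mem_support_powWalk _).1 hm
    have hh := D.φ_t_pow hσ (D.enl.pt x) i; have hp := D.enl.φ_pt x; rw [enl_φ] at hp
    exact hout (Or.inl (by rw [hi, hh.1, hp.1])) h
  · have hm := Walk.dart_fst_mem_support_of_mem_darts _ hd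
    obtain ⟨i, -, hi⟩ := (mem_support_powWalk _).1 hm
    have hh := D.enl.φ_s₀_pow (D.c₁ σ x) i; have hc := D.φ_c₁ x hσ; rw [enl_φ] at hh
    exact hout (Or.inr (Or.inr (by rw [hi, hh.2, hc.2]))) h
  · exact D.darts_seg x y hσ hd ⟨h, h'⟩
  · have hm := Walk.dart_fst_mem_support_of_mem_darts _ hd
    obtain ⟨i, -, hi⟩ := (mem_support_powWalk _).1 hm
    have hh := D.φ_t_inv_pow hσ (D.c₃ σ x y) i
    have hend := D.φ_t_inv_pow hσ (D.c₃ σ x y) (D.m₂ σ y)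
    rw [D.c₃_end x y] at hend
    have hq := D.enl.φ_qt y; rw [enl_φ] at hq
    exact hout (Or.inr (Or.inl (by rw [hi, hh.1, ← hend.1, hq.1]))) h

/-- The length of the frame. [folklore] -/
theorem length_frame (hσ : σ = 1 ∨ σ = -1) :
    (D.frame σ x y hσ).length = D.m₁ σ x + 2 * (ℓ + 1) + D.admLen σ (D.kel σ x y) + D.m₂ σ y := by
  rw [frame, Walk.length_append, Walk.length_append, Walk.length_append, Walk.length_copy, length_seg, length_powWalk,
    length_powWalk, length_powWalk]
  ring

/-- The column of `x` stays in the big cylinder. [folklore] -/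
theorem colA_mem : ∀ z ∈ (powWalk S (fun g => adj_mul_of_mem S (t := D.enl.s₀⁻¹) (Or.inl (D.inv_mem _ D.s₀_mem)) (inv_ne_one.2 D.enl.s₀_ne_one) g)
    x.1 (D.enl.nA x)).support, z ∈ D.enl.V (ℓ + 1) := by
  intro z hz
  obtain ⟨i, hi, rfl⟩ := (mem_support_powWalk _).1 hz
  have h := D.enl.φ_s₀inv_pow x.1 i; have hx := D.memV.1 x.2; have e := D.enl.nA_eq x
  have hi' : (i : ℤ) ≤ D.enl.nA x := by exact_mod_cast hi
  rw [enl_φ] at h e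
  rw [abs_le, abs_le] at hx
  rw [D.memV, abs_le, abs_le, h.1, h.2]; omega

/-- The column of `y` stays in the big cylinder. [folklore] -/
theorem colB_mem : ∀ z ∈ (powWalk S (fun g => adj_mul_of_mem S (t := D.enl.s₀) (Or.inl D.s₀_mem) D.enl.s₀_ne_one g) y.1 (D.enl.nB y)).support,
    z ∈ D.enl.V (ℓ + 1) := by
  intro z hz
  obtain ⟨i, hi, rfl⟩ := (mem_support_powWalk _).1 hz
  have h := D.enl.φ_s₀_pow y.1 i; have hy := D.memV.1 y.2; have e := D.enl.nB_eq y
  have hi' : (i : ℤ) ≤ D.enl.nB y := by exact_mod_cast hi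
  rw [enl_φ] at h e
  rw [abs_le, abs_le] at hy
  rw [D.memV, abs_le, abs_le, h.1, h.2]; omega

/-- **The column of `x` down to the floor**, as a walk of `H`. [folklore] -/
def colA : (D.cylG (ℓ + 1)).Walk x (D.enl.pV x) :=
  (powWalk S (fun g => adj_mul_of_mem S (t := D.enl.s₀⁻¹) (Or.inl (D.inv_mem _ D.s₀_mem)) (inv_ne_one.2 D.enl.s₀_ne_one) g) x.1 (D.enl.nA x)).induce
    (D.enl.V (ℓ + 1)) (D.colA_mem x)

/-- **The column of `y` up to the ceiling, reversed**, as a walk of `H`. [folklore] -/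
def colB : (D.cylG (ℓ + 1)).Walk (D.enl.qV y) y :=
  ((powWalk S (fun g => adj_mul_of_mem S (t := D.enl.s₀) (Or.inl D.s₀_mem) D.enl.s₀_ne_one g) y.1 (D.enl.nB y)).induce (D.enl.V (ℓ + 1))
    (D.colB_mem y)).reverse

variable (σ)

/-- **The signed frame as a simple path of `H`.** [folklore] -/
def pathM (hσ : σ = 1 ∨ σ = -1) : (D.cylG (ℓ + 1)).Walk (D.enl.pV x) (D.enl.qV y) :=
  ((D.frame σ x y hσ).induce (D.enl.V (ℓ + 1)) fun _ hz => (D.frame_mem x y hσ hz).1).bypass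

variable {σ}

/-- Vertices of `colA` are `x s₀^{−i}`, `i ≤ nA`. [folklore] -/
theorem mem_colA {z : D.enl.V (ℓ + 1)} (hz : z ∈ (D.colA x).support) : ∃ i, i ≤ D.enl.nA x ∧ z.1 = x.1 * D.enl.s₀⁻¹ ^ i :=
  (mem_support_powWalk _).1 ((mem_support_induce_iff _ (D.colA_mem x) z).1 hz)

/-- Vertices of `colB` are `y s₀^{j}`, `j ≤ nB`. [folklore] -/
theorem mem_colB {z : D.enl.V (ℓ + 1)} (hz : z ∈ (D.colB y).support) : ∃ j, j ≤ D.enl.nB y ∧ z.1 = y.1 * D.enl.s₀ ^ j := by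
  have hz' := (mem_support_reverse_iff _ z).1 hz
  exact (mem_support_powWalk _).1 ((mem_support_induce_iff _ (D.colB_mem y) z).1 hz')

/-- Vertices of `pathM` are frame vertices. [folklore] -/
theorem mem_pathM (hσ : σ = 1 ∨ σ = -1) {z : D.enl.V (ℓ + 1)} (hz : z ∈ (D.pathM σ x y hσ).support) :
    z.1 ∈ (D.frame σ x y hσ).support :=
  (mem_support_induce_iff _ _ _).1 (support_bypass_subset_support _ hz)

/-- Edges of `pathM` have an endpoint outside the small cylinder. [folklore] -/
theorem edges_pathM (hσ : σ = 1 ∨ σ = -1) {a b : D.enl.V (ℓ + 1)} (h : s(a, b) ∈ (D.pathM σ x y hσ).edges) :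
    D.φ a.1 ∉ box 2 ℓ ∨ D.φ b.1 ∉ box 2 ℓ := by
  have h1 := mem_edges_of_mem_edges_induce _ _ (edges_bypass_subset_edges _ h)
  obtain ⟨d, hd, hab⟩ := exists_dart_of_mem_edges _ h1
  have hfd := D.frame_darts x y hσ hd
  rcases hab with ⟨ha, hb⟩ | ⟨hb, ha⟩
  · rw [ha, hb] at hfd; exact hfd
  · rw [ha, hb] at hfd; exact hfd.symm

end KitDir

end CylData₁

end CayCyl

end Summit.CriticalPhenomena.PercolationContinuityZ3.Theorems.Transplant

end
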